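import Literature.MathematicalPhysics.QuantumManyBody.PeriodicConfigFourier

/-!
# Route `BECClassicalWindow` — support item `ThermalGroundStateLimit` (stmt-AtomisticToContinuum-9073):
# Bessel's inequality for the Fourier coefficients of an orthonormal family of Dirichlet states

Helper file for stmt-AtomisticToContinuum-9073 (`ThermalGroundStateLimit`, the `β → ∞` step of the
route). The analytic input of that item is the finiteness of the partition function of the
Dirichlet box at fixed `N, L`, which the tree has to express on finite orthogonal ENSEMBLES of
`C¹` trial states (no operators). Its first ingredient, proved here, is **Bessel's inequality in
momentum space**: for a finite family `(Ψᵢ)` of Dirichlet trial states of `Λ_L^N` that is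
orthonormal in `L²((ℝ³)^N)` and every momentum `n ∈ ℤ^{3N}`,

  `∑ᵢ |ĉₙ(Ψᵢ^per)|² ≤ L^{-3N}`,

where `Ψ^per = periodize L Ψ` is the `(Lℤ³)^N`-periodisation (it coincides with `Ψ` on the cell)
and `ĉₙ` are the cell Fourier coefficients `configFourierCoeff` of `PeriodicConfigFourier.lean`
(normalised so that Parseval reads `∑ₙ |ĉₙ(Ψ)|² = L^{-3N} ∫_{cell} |Ψ|²`). Proof: the induced torus
functions, rescaled by `L^{3N/2}`, are orthonormal in `L²((ℝ/ℤ)^{3N})` (Haar probability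
measure, activated term-locally as in `Analysis.Fourier.AddCircleMulti` — no instance is declared
in this file); Mathlib's Bessel inequality (`Orthonormal.sum_inner_products_le`) against the plane
wave `e_n` of the Hilbert basis `UnitAddTorus.mFourierBasis`, whose coefficients are the `ĉₙ`.
-/

noncomputable section

namespace Summit.AtomisticToContinuum.BoseEinsteinCondensation.Theorems

open MeasureTheory Filter Set WithLp Complex UnitAddTorus
open scoped ENNReal NNReal Topology ComplexConjugate InnerProductSpace
open Literature.MathematicalPhysics.QuantumManyBody.BoseGas
open Literature.MathematicalPhysics.QuantumManyBody

namespace ThermalGroundStateLimit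

variable {N : ℕ} {L : ℝ}

/-- The periodisation of a Dirichlet trial state is `C¹`. [folklore] -/
theorem contDiff_periodize_trialState (hL : 0 < L) (Ψ : TrialState N L) :
    ContDiff ℝ 1 (periodize L Ψ.ψ) :=
  contDiff_periodize hL le_rfl Ψ.contDiff Ψ.eq_zero

/-- The periodisation of a Dirichlet trial state is continuous. [folklore] -/
theorem continuous_periodize_trialState (hL : 0 < L) (Ψ : TrialState N L) :
    Continuous (periodize L Ψ.ψ) :=
  (contDiff_periodize_trialState hL Ψ).continuous

/-- The periodisation of a Dirichlet trial state is `(Lℤ³)^N`-periodic. [folklore] -/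
theorem isTorusPeriodic_periodize_trialState (hL : 0 < L) (Ψ : TrialState N L) :
    IsTorusPeriodic L (periodize L Ψ.ψ) := by
  intro X i k
  rw [single_single_eq_latticeVecN, periodize_add_latticeVecN hL.ne']

/-- `∫ conj(Ψ) Ψ = 1` for a Dirichlet trial state (the normalisation as a Bochner integral).
[folklore] -/
theorem integral_conj_mul_self (Ψ : TrialState N L) : ∫ X, conj (Ψ.ψ X) * Ψ.ψ X = 1 := by
  have h1 : (fun X => conj (Ψ.ψ X) * Ψ.ψ X) = fun X => (((‖Ψ.ψ X‖ ^ 2 : ℝ)) : ℂ) := by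
    funext X; rw [Complex.conj_mul', Complex.ofReal_pow]
  rw [h1, integral_complex_ofReal]
  have h2 : ∫ X, ‖Ψ.ψ X‖ ^ 2 = (∫⁻ X, (‖Ψ.ψ X‖₊ : ℝ≥0∞) ^ 2).toReal := by
    rw [integral_eq_lintegral_of_nonneg_ae (f := fun X => ‖Ψ.ψ X‖ ^ 2)
      (Eventually.of_forall fun X => sq_nonneg _)
      ((Ψ.contDiff.continuous.norm.pow 2).aestronglyMeasurable)]
    simp only [← coe_nnnorm_sq_eq_ofReal]
  rw [h2, Ψ.norm_eq, ENNReal.toReal_one, Complex.ofReal_one]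

/-- On the cell the inner product of two periodised Dirichlet states is the `L²((ℝ³)^N)` inner
product of the states. [folklore] -/
theorem setIntegral_cellN_conj_periodize_mul (hL : 0 < L) (Ψ Φ : TrialState N L) :
    ∫ X in cellN N L, conj (periodize L Ψ.ψ X) * periodize L Φ.ψ X =
      ∫ X, conj (Ψ.ψ X) * Φ.ψ X := by
  rw [setIntegral_congr_fun (measurableSet_cellN N L) (fun X hX => by
    rw [periodize_of_mem_cellN hL Ψ.ψ hX, periodize_of_mem_cellN hL Φ.ψ hX])]
  refine setIntegral_eq_integral_of_forall_compl_eq_zero fun X hX => ?_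
  rw [Φ.eq_zero X fun h => hX (boxN_subset_cellN le_rfl h), mul_zero]

/-- **Bessel's inequality in momentum space.** For a finite `L²((ℝ³)^N)`-orthonormal family of
Dirichlet trial states of `Λ_L^N` and every `n ∈ ℤ^{3N}`,
`∑ᵢ |ĉₙ(periodize L Ψᵢ)|² ≤ L^{-3N}` (cell Fourier coefficients of `PeriodicConfigFourier.lean`).
Proof: with Mathlib's Haar probability measure on `ℝ/ℤ` (term-local instance, as in
`Analysis.Fourier.AddCircleMulti`; no instance is declared here) the induced torus functions
rescaled by `L^{3N/2}` are orthonormal in `L²((ℝ/ℤ)^{3N})`, and Bessel's inequality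
(`Orthonormal.sum_inner_products_le`) against the plane wave `mFourierBasis n` gives the claim.
[folklore] -/
theorem sum_sq_configFourierCoeff_le (hL : 0 < L) {ι : Type*} [Fintype ι] (Ψ : ι → TrialState N L)
    (horth : ∀ i j, i ≠ j → ∫ X, conj ((Ψ i).ψ X) * (Ψ j).ψ X = 0) (n : Fin N × Fin 3 → ℤ) :
    ∑ i, ‖configFourierCoeff L (periodize L (Ψ i).ψ) n‖ ^ 2 ≤ ((L ^ 3)⁻¹) ^ N := by
  classical
  -- Mathlib's (local) Haar probability measure on `ℝ/ℤ`, as in `AddCircleMulti`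
  letI : MeasureSpace UnitAddCircle := instMeasureSpaceUnitAddCircle
  have hL3N : 0 < (L ^ 3) ^ N := by positivity
  have hinv : (L ^ 3) ^ N * ((L ^ 3)⁻¹) ^ N = 1 := by
    rw [inv_pow, mul_inv_cancel₀ hL3N.ne']
  set c : ℝ := Real.sqrt ((L ^ 3) ^ N) with hc
  have hc2 : c ^ 2 = (L ^ 3) ^ N := Real.sq_sqrt hL3N.le
  have hcc : c * c = (L ^ 3) ^ N := Real.mul_self_sqrt hL3N.le
  have hcpos : 0 < c := Real.sqrt_pos.2 hL3N
  have hcont : ∀ i, Continuous (periodize L (Ψ i).ψ) := fun i =>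
    continuous_periodize_trialState hL (Ψ i)
  set f : ι → Lp ℂ 2 (volume : Measure (UnitAddTorus (Fin N × Fin 3))) := fun i =>
    (memLp_torusFunN hL (hcont i)).toLp _ with hf
  -- inner products of the induced torus functions
  have htorus : ∀ i j, ∫ t, conj (torusFunN L (periodize L (Ψ i).ψ) t) *
      torusFunN L (periodize L (Ψ j).ψ) t =
      ((((L ^ 3)⁻¹) ^ N : ℝ) : ℂ) * ∫ X, conj ((Ψ i).ψ X) * (Ψ j).ψ X := by
    intro i j
    have hcij : Continuous fun X => conj (periodize L (Ψ i).ψ X) * periodize L (Ψ j).ψ X :=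
      (Complex.continuous_conj.comp (hcont i)).mul (hcont j)
    have h := integral_fromUnitTorusN hL
      (G := fun X => conj (periodize L (Ψ i).ψ X) * periodize L (Ψ j).ψ X) hcij.aestronglyMeasurable
    simp only [torusFunN]
    rw [h, setIntegral_cellN_conj_periodize_mul hL, Complex.real_smul]
  -- the rescaled torus functions are orthonormal
  have hon : Orthonormal ℂ fun i => (c : ℂ) • f i := by
    rw [orthonormal_iff_ite]
    intro i j
    rw [inner_smul_left, inner_smul_right, Complex.conj_ofReal, ← mul_assoc, ← Complex.ofReal_mul,
      hcc, L2.inner_def]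
    have hij : ∫ t, ⟪f i t, f j t⟫_ℂ =
        ∫ t, conj (torusFunN L (periodize L (Ψ i).ψ) t) * torusFunN L (periodize L (Ψ j).ψ) t := by
      refine integral_congr_ae ?_
      filter_upwards [(memLp_torusFunN hL (hcont i)).coeFn_toLp,
        (memLp_torusFunN hL (hcont j)).coeFn_toLp] with t hi hj
      rw [hf]
      dsimp only
      rw [hi, hj, RCLike.inner_apply, mul_comm]
    rw [hij, htorus, ← mul_assoc, ← Complex.ofReal_mul, hinv, Complex.ofReal_one, one_mul]
    split_ifs with h
    · subst h; exact integral_conj_mul_self (Ψ i)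
    · exact horth i j h
  -- Bessel against the plane wave `e_n`
  set e : Lp ℂ 2 (volume : Measure (UnitAddTorus (Fin N × Fin 3))) := mFourierBasis n with he
  have hB := hon.sum_inner_products_le e (s := Finset.univ)
  have he1 : ‖e‖ = 1 := (mFourierBasis (d := Fin N × Fin 3)).orthonormal.norm_eq_one n
  rw [he1, one_pow] at hB
  have hterm : ∀ i, ‖⟪(c : ℂ) • f i, e⟫_ℂ‖ ^ 2 =
      c ^ 2 * ‖configFourierCoeff L (periodize L (Ψ i).ψ) n‖ ^ 2 := by
    intro i
    rw [norm_inner_symm, inner_smul_right, norm_mul, Complex.norm_real, Real.norm_of_nonneg hcpos.le,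
      mul_pow, he, ← HilbertBasis.repr_apply_apply, mFourierBasis_repr, hf,
      mFourierCoeff_toLp_torusFunN hL (hcont i)]
  simp only [hterm, ← Finset.mul_sum] at hB
  rw [hc2] at hB
  rw [inv_pow, ← one_div, le_div_iff₀' hL3N]
  exact hB

end ThermalGroundStateLimit

end Summit.AtomisticToContinuum.BoseEinsteinCondensation.Theorems

end
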